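import Mathlib
import Literature.Computability.Complexity.Classes
import Literature.Computability.Complexity.Nondeterministic
import Literature.Computability.Complexity.BoolEncodings
import Literature.Computability.Complexity.CNF
import Literature.Computability.MetaComplexity.ProofSystems
import Literature.Computability.MetaComplexity.Frege
import Literature.Computability.Cryptography.OneWayFunctions
import Summits.PneNP.PneNP.Theorems.LatticeMagicTargetIffNPneCoNP
import Summits.PneNP.PneNP.Theorems.LatticeMagicTargetStubAmgm
import Summits.PneNP.PneNP.Theorems.LatticeMagicTargetDefs
import Summits.PneNP.PneNP.Theorems.LatticeMagicTargetSqueezeStrength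
import Summits.PneNP.PneNP.Theorems.LatticeMagicTargetSqueezeVacuity
import Summits.PneNP.PneNP.Theorems.LatticeMagicTargetStubLevin
import Summits.PneNP.PneNP.Theorems.LatticeMagicTargetStubBridge
import Summits.PneNP.PneNP.Theorems.LatticeMagicTargetStubGame

/-!
# Line `SketchIdeator5` — crux `Target` of route LatticeMagic (stmt-PneNP-10709) — LEAD SKELETON (seat a1)

Card `kpt-squeeze-ideal-lattice-leg` (ideator 5, round 2): Krajíček's model-extension squeeze
(J. Krajíček, *A proof complexity conjecture and the Incompleteness theorem* companion note
= arXiv:2506.20221, Thm 4.1: MEP ∧ (ST) ⟹ NP ≠ coNP) with the cryptographic leg (ST) supplied by an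
INJECTIVE one-way family (FIRST LEMMA: a self-sampling predictor, no permutation needed) whose
injectivity is a theorem (ideal lattices, AM–GM), composed into the crux through the landed bridge
`Summit.PneNP.PneNP.Theorems.latticeMagicTarget_of_NP_ne_coNP` (`Target ↔ NP ≠ coNP`, p101056).

STATUS r4 (2026-08-16): CLOSED MODULO {`stub_injOWF`, `stub_squeeze`} — the two conjecture-grade apexes;
every other stub below is a tree theorem. Registered stubs (the `sorry`s of this file are only the apexes):
* `stub_injOWF`  — APEX A (conjecture-grade, Minicrypt): an injective-on-lengths, length-regular
  one-way function with a hard-core predicate exists (intended witness: the Goldreich–Levin extension of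
  the partial-NTT / ideal-lattice syndrome map; classical witness: any one-way permutation + GL).
* `stub_game`    — FIRST LEMMA: one-way + hard-core ⟹ the hard-bit vector game is hard for FP
  students with O(1) rounds (a PPT reduction; the tree's `RandAlg` model) — CLOSED: landed p120272
  `Theorems/LatticeMagicTargetStubGame.lean` (chain Combinatorics p112892 / Bricks p120002 / Machine p120105).
* `stub_levin`   — (reshape r2) Cook–Levin with the LEVIN WITNESS MAP in `FP` (reusable tree fact; the
  first wall of the bridge) — CLOSED: landed p115006 `Theorems/LatticeMagicTargetStubLevin.lean`.
* `stub_bridge`  — game-hard + injective + p-time (+ `stub_levin` as hypothesis) ⟹ Krajíček's (ST) for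
  some Cook–Reckhow pps `V` (`V := Frege-verifier ⊕ {regenerated game tautologies}` — "EF + a p-time set
  of tautologies" in the source; arXiv:2506.20221 §2, after Krajíček LMCS 16(3:9) 2020). r1 asked for
  `V ⊇ EF` (`StrongST`); r2 drops the strength clause (immaterial for Thm 4.1, `stHyp_mono`) —
  CLOSED: landed p119868 `Theorems/LatticeMagicTargetStubBridge.lean` (+ Forms/Instance/Code/Verifier/Student).
* `stub_squeeze` — APEX B (conjecture-grade): for every pps `V` for TAUT, `STHyp V → NP ≠ coNP` —
  Thm 4.1 of arXiv:2506.20221 WITH ITS HYPOTHESIS MEP (Problem 3.2, open) FOLDED IN (MEP is not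
  statable in the tree today: no models of `T_PV`, no ‖·‖ⁿ translation).
* `stub_amgm`    — the lattice leg's injectivity certificate (AM–GM minimum bound for ideals of
  number rings) — CLOSED: landed p110267 `Theorems/LatticeMagicTargetStubAmgm.lean`. It enters `Target_of` only through the intended witness of
  `stub_injOWF` (documented orphan w.r.t. the composition).

Composition: `stub_injOWF, stub_game, stub_levin, stub_bridge ⊢ ∃ V, IsProofSystemFor V TAUT ∧ STHyp V`;
`stub_squeeze ⊢ … → NP ≠ coNP`;
`latticeMagicTarget_of_NP_ne_coNP ⊢ Target` — `Target_of` below, hypothesis-free modulo the stubs.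
-/

set_option linter.dupNamespace false -- `Summit.PneNP.PneNP` is the mandated summit-side namespace

namespace Summit.PneNP.PneNP.Cruxes.Target.SketchIdeator5

open Literature.Computability.Complexity Literature.Computability.Cryptography
open Literature.Computability.MetaComplexity
open _root_.Computability

/-! ### 1–2. Vocabulary

The hard-bit vector game (`HBInstance`, `hbView`, `Wrong`, `Teacher`, `hbHist`, `hbProposal`, `HBLegal`,
`HBWins`, `STGameHard`) and Krajíček's `DD_V` problem (`bigDisj`, `DDInstance`, `ddView`, `DDTeacher`,
`ddHist`, `ddProposal`, `DDLegal`, `DDWins`, `STHyp`, `SimulatesEF`, `StrongST`, `InjOnLengths`) now live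
in the TREE: `Summits/PneNP/PneNP/Theorems/LatticeMagicTargetDefs.lean` (p112054, verbatim the former
§1–§2 of this skeleton), opened below. -/

open Summit.PneNP.PneNP.Theorems.LatticeMagicTarget

/-! ### 3. Registered stubs -/

/-- **APEX A** (conjecture-grade; `stub_injOWF`). There is a polynomial-time function `g` that is
injective on each length, length-regular and (strongly, uniformly) one-way, together with a
hard-core predicate `B` for it. Classical source: any one-way PERMUTATION `f` gives `g = glFun f`,
`B = glPred` by Goldreich–Levin (tree: `goldreich_levin_holds`, `isOneWay_glFun_holds`, PROVED). The
card's trapdoor-free lattice witness: the GL-extension of the partial-NTT syndrome map on binary /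
short errors, injective by `stub_amgm`. STRENGTH: implies `OWFExist`, hence `P ≠ NP`
(`P_ne_NP_of_OWFExist_holds`) — ≥ the summit, not known ≥ the crux. [Goldreich 2001, Def. 2.2.1, 2.5.1] -/
theorem stub_injOWF :
    ∃ (g : List Bool → List Bool) (B : List Bool → Bool),
      InjOnLengths g ∧ IsLengthRegular g ∧ IsOneWay g ∧ IsHardCorePredicate B g := by
  sorry

/-- **FIRST LEMMA** (`stub_game`; card `kpt-squeeze-ideal-lattice-leg` §First lemma). A strong
one-way function with a hard-core predicate makes the hard-bit vector game hard for p-time students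
with O(1) rounds. Proof on paper: plant the challenge at a uniformly random coordinate `ρ` of
`t = 2k+2`, self-sample the other coordinates WITH their preimages, play the teacher "reveal the
lowest wrong coordinate `≠ ρ`", output the student's bit at `ρ` the first time all coordinates `≠ ρ`
are right; advantage `≥ 1/(k+1)` for all large `n`, contradicting `IsHardCorePredicate`. Neither
injectivity nor surjectivity of `g` is used. -/
theorem stub_game (g : List Bool → List Bool) (B : List Bool → Bool)
    (hg : IsOneWay g) (hB : IsHardCorePredicate B g) : STGameHard g B :=
  -- CLOSED: stub_game LANDED (p120272 Theorems/LatticeMagicTargetStubGame.lean, chain p112892/p120002/p120105; worker W2)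
  Summit.PneNP.PneNP.Theorems.LatticeMagicTarget.stub_game g B hg hB

/-- **LEVIN WITNESS MAP** (`stub_levin`; reshape r2 — the first wall of the bridge, stated as a
reusable tree-vocabulary fact). Cook–Levin WITH THE LEVIN HALF: for a polynomial-time relation
`R` (pairs `boolPair x u`) and certificate bound `p`, there are a CNF family `Φ x`, its code generator
`gen ∈ FP` and a WITNESS MAP `wit ∈ FP` such that `Φ x` is satisfiable iff some `u`, `|u| ≤ p |x|`, has
`boolPair x u ∈ R`, and from any such `u` the map `wit` computes (the bit list of) a satisfying
assignment of `Φ x`. The decision half (`Φ`, `gen`, the `↔`) is the tree's `CookLevin.cnfN` /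
`reduceSAT_mem_FP` / `reduceSAT_mem_SAT_iff`; the new content is `wit ∈ FP` (tabulating
`Tableau.intended`, the accepting run, in polynomial time). [Arora–Barak 2009, Lemma 2.11 and
§2.3.6 "Levin reductions"; folklore] -/
theorem stub_levin (R : Language Bool) (hR : R ∈ Classes.P) (p : Polynomial ℕ) :
    ∃ (Φ : List Bool → CNF ℕ) (gen wit : List Bool → List Bool), gen ∈ FP ∧ wit ∈ FP ∧
      (∀ x, gen x = encodingCNF.encode (Φ x)) ∧
      (∀ x, (Φ x).Satisfiable ↔ ∃ u : List Bool, u.length ≤ p.eval x.length ∧ boolPair x u ∈ R) ∧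
      (∀ x u, u.length ≤ p.eval x.length → boolPair x u ∈ R →
        (Φ x).eval (fun i => (wit (boolPair x u)).getD i false) = true) :=
  -- CLOSED: stub_levin LANDED (p115006, Theorems/LatticeMagicTargetStubLevin.lean, worker W4)
  Summit.PneNP.PneNP.Theorems.LatticeMagicTarget.stub_levin R hR p

/-- **BRIDGE** (`stub_bridge`; reshape r2; arXiv:2506.20221 §2 with Krajíček LMCS 16(3:9) 2020).
If `g` is p-time, injective on each length and length-regular, `B` is p-time, and the hard-bit vector
game for `(g, B)` is hard, then — given the Levin witness map (`stub_levin`, passed as the hypothesis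
`hlevin`) — some Cook–Reckhow proof system `V` for `TAUT` has `DD_V ∉ ST[FP, O(1)]`. Intended `V`
(cheapest design, worker W3 findings): `V x (false :: c) := FregeVerifier c` (the tree's sound and
complete p-time Frege verifier) and `V x (true :: r) := (x = F r)` where `F ∈ FP` regenerates from
`r = ⟨1ⁿ, w⃗, pad⟩` the code of the disjoint disjunction `⋁_{v ∈ {0,1}ᵗ} ⋀_{j<t} ¬Φ⟨1ⁿ, w_j, v_j⟩`
(`Φ` the Cook–Levin CNF of `R_{g,B} = {⟨⟨1ⁿ, w, c⟩, u⟩ : |u| = n ∧ g u = w ∧ B u ≠ c}`, blocks relabelled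
apart) — a TAUTOLOGY for every `w⃗` exactly because `g` is injective on length `n` (so `V` is sound with
no EF reasoning about `g`: Krajíček's "EF + a p-time set of tautologies" with the set tailored to `g`);
a DD-student for these instances is turned into a game-student (`∈ FP`: regenerate the instance from the
view, replay `S`, translate each revealed `(j, u_j)` into the falsifying assignment `wit ⟨…, u_j⟩` of the
proposed disjunct), and `hgame` at `k + 1` rounds defeats it (round 0 is spent learning `n` from the first
reveal — the game view carries no `1ⁿ`). REMARK: the strength clause "V ⊇ EF" of the source's (ST) is
dropped from the composition (r2): by `stHyp_mono` hardness passes to any extension `V ⊔ EF`, and the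
proof of Thm 4.1 uses no strength of the witness (see `stub_squeeze`). -/
theorem stub_bridge
    (hlevin : ∀ (R : Language Bool), R ∈ Classes.P → ∀ p : Polynomial ℕ,
      ∃ (Φ : List Bool → CNF ℕ) (gen wit : List Bool → List Bool), gen ∈ FP ∧ wit ∈ FP ∧
        (∀ x, gen x = encodingCNF.encode (Φ x)) ∧
        (∀ x, (Φ x).Satisfiable ↔ ∃ u : List Bool, u.length ≤ p.eval x.length ∧ boolPair x u ∈ R) ∧
        (∀ x u, u.length ≤ p.eval x.length → boolPair x u ∈ R →
          (Φ x).eval (fun i => (wit (boolPair x u)).getD i false) = true))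
    (g : List Bool → List Bool) (B : List Bool → Bool)
    (hpoly : PolyTimeComputable id id g) (hBpoly : PolyTimeComputable id encodeBool B)
    (hinj : InjOnLengths g) (hgame : STGameHard g B) :
    ∃ V : List Bool → List Bool → Bool, IsProofSystemFor V TAUT ∧ STHyp V :=
  -- CLOSED: stub_bridge LANDED (p119868, Theorems/LatticeMagicTargetStubBridge.lean + 5 chain files, worker W5)
  Summit.PneNP.PneNP.Theorems.LatticeMagicTarget.stub_bridge hlevin g B hpoly hBpoly hinj hgame

/-- **APEX B** (conjecture-grade; `stub_squeeze`, reshape r2). Krajíček's Theorem 4.1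
(arXiv:2506.20221 §4) with its model-theoretic hypothesis — the affirmative answer to Problem 3.2
(MEP: every model `M` of `T_PV` has `M ⊆ M* ⊆ M'` with `M*` Σᵇ₁(PV)-elementary over `M`,
`M' ⊨ T_PV + ¬φ ∈ SAT`, `Log M* = Log M'`) — FOLDED IN: for every Cook–Reckhow proof system `V` for
`TAUT`, if `DD_V ∉ ST[FP, O(1)]` then `NP ≠ coNP`. The source states (ST) for a STRONG pps (⊇ EF); its
proof of Thm 4.1 uses of the witness only that it is a pps with `STHyp` — step (1) passes under `NP = coNP`
to a p-bounded extension (`stHyp_mono`), steps (2)–(5) are KPT over `T_PV`, the true sentences `A_Q`,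
MEP and `Ref_P` — so the strength clause is dropped here (r2; r1 had `SimulatesEF V`). MEP is not
statable in the tree today (no `L_PV`-structures ⊨ `T_PV`, no ‖·‖ⁿ translation): definition items first.
STRENGTH: implied by `NP ≠ coNP`; implied by `P = NP` (then no complete `V` has `STHyp V`:
`stHyp_false_of_TAUT_mem_P`, registered sub-goal); given the other stubs it is EQUIVALENT to `NP ≠ coNP`
(`squeeze_iff_NP_ne_coNP_of_ST` below) — the kernel-checked sense in which, under (ST), the line leaves
exactly the crux. -/
theorem stub_squeeze (V : List Bool → List Bool → Bool) (hV : IsProofSystemFor V TAUT)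
    (hST : STHyp V) : Nondeterministic.NP ≠ coNP := by
  sorry

open NumberField in
/-- **AM–GM minimum bound** (`stub_amgm`; the lattice leg's injectivity certificate). For a nonzero
`x` in an ideal `I` of the ring of integers of a number field `K` of degree `n`,
`n · N(I)^{2/n} ≤ ∑_σ |σ x|²` (AM–GM on the `|σ x|²`, `∏_σ |σ x| = |N_{K/ℚ}(x)|`, and
`N(I) ∣ |N_{K/ℚ}(x)|`). Hence the canonical-embedding minimum of `I` is `≥ √n · N(I)^{1/n}`, and for
`K = ℚ(ζ_{2n})`, `I = ∏ᵢ (q, ζ − rᵢ)`, `N(I) = qᵏ` the partial-NTT map `e ↦ (e(rᵢ) mod q)ᵢ` is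
injective on any set of coefficient diameter `< q^{k/n}`. [Neukirch, ANT I §5–6; folklore] -/
theorem stub_amgm (K : Type*) [Field K] [NumberField K] (I : Ideal (𝓞 K))
    (x : 𝓞 K) (hx : x ∈ I) (hx0 : x ≠ 0) :
    (Module.finrank ℚ K : ℝ) * ((Ideal.absNorm I : ℕ) : ℝ) ^ ((2 : ℝ) / (Module.finrank ℚ K : ℝ))
      ≤ ∑ σ : K →+* ℂ, ‖σ (x : K)‖ ^ 2 :=
  -- CLOSED: stub_amgm LANDED (p110267, Theorems/LatticeMagicTargetStubAmgm.lean)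
  Summit.PneNP.PneNP.Theorems.LatticeMagicTarget.stub_amgm K I x hx hx0

/-! ### 4. Composition (proved) -/

/-- The cryptographic leg: apex A + FIRST LEMMA + Levin witness + bridge give Hypothesis (ST)
(for some Cook–Reckhow proof system). -/
theorem st_of_stubs : ∃ V : List Bool → List Bool → Bool, IsProofSystemFor V TAUT ∧ STHyp V := by
  obtain ⟨g, B, hinj, _hreg, hg, hB⟩ := stub_injOWF
  exact stub_bridge stub_levin g B hg.1 hB.1 hinj (stub_game g B hg hB)

/-- The squeeze: (ST) + apex B give `NP ≠ coNP`. -/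
theorem NP_ne_coNP_of_stubs : Nondeterministic.NP ≠ coNP := by
  obtain ⟨V, hV, hST⟩ := st_of_stubs
  exact stub_squeeze V hV hST

/-- **The line closes the crux (modulo its stubs)**: `Target` by name, through the landed bridge
`latticeMagicTarget_of_NP_ne_coNP` (p101056). -/
theorem Target_of : Summit.PneNP.PneNP.Theses.LatticeMagic.Target :=
  Summit.PneNP.PneNP.Theorems.latticeMagicTarget_of_NP_ne_coNP NP_ne_coNP_of_stubs

/-! ### 5. Strength bookkeeping proved inside the skeleton (no new facts) -/

/-- Apex B is implied by the crux's equivalent `NP ≠ coNP` (trivially). -/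
theorem stub_squeeze_of_NP_ne_coNP (h : Nondeterministic.NP ≠ coNP)
    (V : List Bool → List Bool → Bool) (_hV : IsProofSystemFor V TAUT) (_hST : STHyp V) :
    Nondeterministic.NP ≠ coNP :=
  h

/-- Given Hypothesis (ST) (the conclusion of the cryptographic leg), apex B (as a closed statement) is
EQUIVALENT to `NP ≠ coNP`. -/
theorem squeeze_iff_NP_ne_coNP_of_ST
    (hST : ∃ V : List Bool → List Bool → Bool, IsProofSystemFor V TAUT ∧ STHyp V) :
    (∀ V : List Bool → List Bool → Bool, IsProofSystemFor V TAUT → STHyp V →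
        Nondeterministic.NP ≠ coNP) ↔ Nondeterministic.NP ≠ coNP := by
  constructor
  · intro h
    obtain ⟨V, hV, hS⟩ := hST
    exact h V hV hS
  · intro h V _ _
    exact h

/-- Hence, modulo the OTHER stubs (apex A, game, Levin, bridge), apex B is literally the crux's
equivalent `NP ≠ coNP`. -/
theorem squeeze_iff_NP_ne_coNP :
    (∀ V : List Bool → List Bool → Bool, IsProofSystemFor V TAUT → STHyp V →
        Nondeterministic.NP ≠ coNP) ↔ Nondeterministic.NP ≠ coNP :=
  squeeze_iff_NP_ne_coNP_of_ST st_of_stubs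

/-- `STHyp` is monotone along pointwise-weaker verifiers (every `V`-proof is a `V'`-proof): the step
of Thm 4.1 that passes from the (ST)-witness to a p-bounded extension under `NP = coNP`. LANDED in the
Defs file as the registered sub-goal `stHyp_mono` (p112054). -/
theorem STHyp.mono {V V' : List Bool → List Bool → Bool} (hVV' : ∀ x π, V x π = true → V' x π = true)
    (h : STHyp V) : STHyp V' :=
  stHyp_mono V V' hVV' h

/-- Apex A follows from a (uniform) one-way permutation — LANDED certificate
`injOWF_of_oneWayPermutation` (p112224, Goldreich–Levin proved in the tree). -/
theorem stub_injOWF_of_oneWayPermutation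
    (h : ∃ f : List Bool → List Bool, IsOneWay f ∧ IsLengthPreserving f ∧
      ∀ x y : List Bool, x.length = y.length → f x = f y → x = y) :
    ∃ (g : List Bool → List Bool) (B : List Bool → Bool),
      InjOnLengths g ∧ IsLengthRegular g ∧ IsOneWay g ∧ IsHardCorePredicate B g :=
  injOWF_of_oneWayPermutation h

/-- Apex A alone already proves the SUMMIT `PneNP` — LANDED certificate `pneNP_of_injOWF` (p112224):
the price tag of the squeeze line (its cryptographic leg is ≥ the summit, though not known ≥ the crux). -/
theorem pneNP_of_stub_injOWF : _root_.PneNP :=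
  pneNP_of_injOWF stub_injOWF

end Summit.PneNP.PneNP.Cruxes.Target.SketchIdeator5
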